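import Summits.BirchSwinnertonDyer.Rank1Residual.Additive.RamifiedSevenGenusKatoExpUnitLawsPositionOfFP1ExactFrame
import Summits.BirchSwinnertonDyer.Rank1Residual.Additive.RamifiedSevenGenusLatticeTypeLawTransport
import Summits.BirchSwinnertonDyer.Rank1Residual.X12.CMTwoTorsion
import Literature.NumberTheory.EllipticCurves.ComplexMultiplicationBurungaleFlachProofs
import HarnessLib

set_option autoImplicit false

/-!
# `𝒞₇` genus road (crux `EllipticUnitValueSevenOfGZK` = stmt-BirchSwinnertonDyer-19945, K7r): (S-P) = LEMMA P —
# `GenusSeven.latticeTypeLawSeven : <TYPE OF stub_latticeTypeLawSeven VERBATIM>`, the lattice-type / period-position law at 7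

Cell bsd-cm, seat bsd-cm-k-ty1 g37 (literature-prover, explicit unit, claim-free); pen bsd-cm-plan g40 (P-2) brief
`pub/bsd-cm/bsd-cm-plan/g40/SP-BRIEF.md` 27a7727cca63174d and ruling D1186 (c) (ARCH-B as theorems; κ' := s/a₀; Cox 10.9 for the
`255³` branch); critic idea-crit-15 g19 NOTE #47 (B).  PURE KERNEL: theorems only — no `def`, no named fact, no `instance`, no
notation, no `sorry`; the named-fact debt of the line is UNCHANGED (printFacts stays 30).

THE LETTER (zp v24 `Cruxes/EllipticUnitValueSevenOfGZK/Lines/kato_perrin_riou_zp.lean` df4123daf56b4e4d, l.544–578): after the record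
binders (hstar … Φ) and the pin `Φ = katoGenusFrameOfRecord … D₃.toKummerColumnData d →`,

    ∃ (L : PeriodPair) (_ : IsNeronLatticeOf (D₃.W₂.baseChange ℂ) L) (lam0 : ℂ)
      (_ : ∀ z : ℂ, z ∈ L.lattice ↔ ∃ a : 𝓞 Kcm, z = lam0 * ι₀ (a : Kcm)) (κ' : Kcm)
      (_ : ι₀ κ' * ((D₃.W₂.realPeriodRat : ℝ) : ℂ) = ι₀ (s : Kcm) * lam0) (r : ℚ) (_ : (r : ℝ) * W.realPeriodRat = D₃.W₂.realPeriodRat),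
      2 * padicValRat 7 r + padicValRat 7 (Algebra.norm ℚ κ') ≤ (Φ.a : ℤ).

THE PROOF (the c₆-SIGN LAW; brief §A–§E with the three simplifications of STATUS l.4420 accepted in D1186 (c)).  Three files (≤ 400 lines each;
one-file farm witness `g37/RamifiedSevenGenusLatticeTypeLaw.asannounced.lean` 59f5eded6fee373f): §1–§4 = part 1
`RamifiedSevenGenusLatticeTypeLawScalings.lean`, §5–§7 = part 2 `RamifiedSevenGenusLatticeTypeLawTransport.lean`, §8–§9 = THIS file
(namespace `GenusSeven.LatticeTypeLaw`, then the letter):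
* §1 casts: the Néron lattice `L` of `W/ℚ` (`IsNeronLatticeOf (W.baseChange ℂ) L`) has `g₂ = c₄(W_ℝ)/12`, `g₃ = c₆(W_ℝ)/216`, is a REAL
  lattice (`isReal_neron`), and `realPeriodRat W = n_W · Ω₀(L)` (`realPeriodRat_eq`; `n_W ∈ {1, 2}`, `v₇(n_W) = 0`).
* §2 isogeny scalings (`exists_int_scaling`): for a `ℚ`-isogeny `φ : W → W'` of GLOBALLY MINIMAL curves, `kΛ_W ⊆ Λ_{W'}` with
  `k ∈ ℤ ∖ 0`, `k ∣ deg φ` (`exists_rat_mulLeft_lattice_le_of_isogeny` + `integral_neronScaling_of_isGloballyMinimal_holds` twice, the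
  bookkeeping of `SkinnerUrban2014.exists_int_mul_minRealPeriod_eq_of_isogeny`); `ψ ∘ φ = [e]`, `e ∈ {1, 2}` ⇒ `7 ∤ deg φ`
  (`not_seven_dvd_degree`: Cauchy on `ker φ ⊆ W[e]`).
* §3 the ratio `r` (`exists_realPeriodRat_ratio`): `k·Ω₀(Λ_W) = a·Ω₀(Λ₂)`, `k'·Ω₀(Λ₂) = b·Ω₀(Λ_W)` (`IsReal.exists_eq_int_mul`),
  `ab = kk'`, `7 ∤ kk'` ⇒ `r = n₂k/(n_W a) ∈ ℚ`, `r·Ω(W) = Ω(W₂)`, `v₇(r) = 0` — NO CM input.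
* §4 CM field block: `Λ₋₇ = cmRing(−7) = ι₀(𝓞 Kcm)` (`coe_cmPeriodPair_lattice`, `exists_forall_mem_cmRing_discr_iff`, `d_Kcm = −7`), so
  for any lattice `Ω·Λ₋₇`: `z ∈ Ω·Λ₋₇ ↔ ∃ a : 𝓞 Kcm, z = Ω·ι₀ a` (`mem_lattice_iff_of_eq_mulLeft`); `v₇(N s) = 1` (`(N s)² = 49`),
  `v₇(N a) ≥ 0` for `a ∈ 𝓞 Kcm`.
* §5 `Λ₋₇`-arithmetic: `ω₋₇ = −7/2 + i√7/2`; `Λ₋₂₈ ⊆ Λ₋₇` (`ω₋₂₈ = 2ω₋₇ − 7`); and the key lemma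
  `sq_re_pos_of_mem_cmPeriodPair`: `β, β' ∈ Λ₋₇`, `ββ' = K ∈ ℤ`, `7 ∤ K`, `β ≠ 0`, `β² ∈ ℝ` ⇒ `β² > 0` (`Im β = 0`, or else
  `Re β = 0` and `Re(ββ') = −Im β Im β' = −7mm'/4 = K`, `7 ∣ 4K`).
* §6 CM generators and the type TRANSPORT (`c₆_pos_iff_of_isogenyPair`): `Λ₂ = Ω₂·Λ₋₇`, `Ω₂² = t₂`, `t₂ > 0 ↔ c₆(W₂) > 0`
  (`exists_cm_generator_of_j_eq_neg_3375`: Cox Thm. 10.9 + `j(Λ₋₇) = −3375` + σ₇ = +1, all PROVED in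
  `Literature/…/EisensteinValuesAtSqrtNegSeven.lean`); `Λ_W = Ω_W·Λ_d`, `d ∈ {−7, −28}` by `j(W) ∈ {−3375, 255³}` (`j(Λ₋₂₈) = 255³`,
  σ₂₈ = +1 PROVED), `t_W > 0 ↔ c₆(W) > 0`; `β := kΩ_W/Ω₂`, `β' := k'Ω₂/Ω_W ∈ Λ₋₇`, `ββ' = kk'`, `β² = k²t_W/t₂ ∈ ℝ` ⇒ §5 ⇒
  `t_W/t₂ > 0`: **`c₆(W) > 0 ↔ c₆(W₂) > 0`**.
* §7 member law (`c₆_neg_of_memberType_eq_zero`): `memberType W = 0 ⇒ c₆(W) < 0` (`memberType_eq_zero_iff`: `C • W` = negative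
  quadratic twist of `B₂ = ⟨0,−42,0,−7,0⟩` (`c₆ = 4826304`) or of `B₁ = B₂.twoIsogenyCodomain = ⟨0,84,0,1792,0⟩` (`c₆ = 5419008`);
  `quadraticTwist_c₆`, `variableChange_c₆`: `u⁻⁶c₆(W) = δ³c₆(B) < 0`).
* §8 core (`latticeTypeLaw_core`, model level, over the pair `(φ₀, ψ₀)`): `L := Λ₂`, `lam0 := Ω₂`; `Ω(W₂) = n₂Ω₀(Λ₂) ∈ Λ₂` gives
  `Ω(W₂) = Ω₂·ι₀ a₀`, `a₀ ≠ 0`, and **`κ' := s/a₀`** satisfies the letter's identity on the nose; `v₇(N κ') = 1 − v₇(N a₀) ≤ 1`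
  ALWAYS (closes `a = 1`); if `memberType W = 0`: §7 ⇒ `c₆(W) < 0` ⇒ (§6) `c₆(W₂) < 0` ⇒ `t₂ < 0` ⇒ `Ω₂ ∈ iℝ` ⇒ `ι₀ a₀ = Ω(W₂)/Ω₂ ∈
  iℝ ∩ Λ₋₇`, `ι₀ a₀ = i m√7/2`, `a₀² = (m²/4)s²` (injectivity of `ι₀`), `κ'² = 4/m²`, `2v₇(N κ') = v₇((4/m²)²) = −4v₇(m) ≤ 0`.
* §9 the letter: `Φ.a = memberType W` (`rfl` after `subst`), instances `D₃.isElliptic_W₂`, `D₃.isGloballyMinimal_W₂`, and §8 at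
  `(W, D₃.W₂, D₃.j_W₂, D₃.φ₀, D₃.ψ₀, D₃.e_eq, D₃.ψφ, D₃.φψ)` with `j(W) ∈ {−3375, 255³}` from `X12.j_eq_of_cmFieldDiscrOfJ_eq_neg_seven hC.2.1`.

HONEST LABEL: a kernel theorem with NO named-fact hypothesis beyond the stub's own binders (of which only `hC`, `h2`, `s`, `hs`, `ι₀`,
`D₃` and the pin are used); it proves the registered research stub (S-P) BY ITS TYPE, for the pen to close in-file
(`latticeTypeLawSeven_closed := GenusSeven.latticeTypeLawSeven`); it does NOT discharge `stub_printFactsKato`, PR^× or hR3c;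
stmt-BirchSwinnertonDyer-19945 stays OPEN until the pen's touch; `X12.CMRamifiedSeven` is NOT proved; no summit statement is proved by
this seat; BSD is claimed for no curve.

## References
* K. Kato, Astérisque 295 (2004), §15.11 (2) (pp. 261–262), (15.16.1) (p. 265), Thm. 12.5 (1) (p. 221). [Kato2004Asterisque]
* D. A. Cox, *Primes of the form x² + ny²*, 2nd ed. (2013), Thm. 10.9, §7.A (7.1), §12.C table (12.20). [Cox2013]
* J. H. Silverman, *AEC* (2009), Thm. VI.4.1 (b), VI.5.1, Cor. VI.5.1.1, C.16; *ATAEC* (1994), IV.5–6, Cor. IV.9.1. [SilvermanAEC2009] [SilvermanATAEC1994]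
* J. Coates, Y. Li, Y. Tian, S. Zhai, Proc. LMS 110 (2015), §2 («𝔏 = Ω_∞𝒪» for `X₀(49)`). [CoatesLiTianZhai2015]
* J. E. Cremona, *Algorithms* (1997), §3.7, Table 1 N = 49. [CremonaAlgorithms1997]
* Tree: `Literature/…/EisensteinValuesAtSqrtNegSeven.lean` (this seat, p831883), `PastenHeightBoundsIsogenyProofs`, `NeronIsogenyScalingHoldsProofs`,
  `RealLatticePeriodDiscrProofs`, `BSDQuadraticDescentArchimedeanProofs`, `CMLatticeOverHilbertClassNumberOne`, `RamifiedSevenGenusMemberType`,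
  `PinnedKatoGenusFrameOfRecord{,Rat}`; zp v24 l.544–578.
-/

noncomputable section

open scoped NumberField TensorProduct ComplexConjugate
open WeierstrassCurve Field NumberField IsDedekindDomain
open Literature.NumberTheory.IwasawaTheory
open Literature.NumberTheory.GaloisRepresentations Literature.NumberTheory.GaloisRepresentations.LocalWeilDatum
open Literature.NumberTheory.EllipticCurves
open Literature.NumberTheory.EllipticCurves.Rank1Residual
open Literature.NumberTheory.EllipticCurves.IwasawaAlgebra
open Literature.NumberTheory.EllipticCurves.Kato2004
open Literature.NumberTheory.EllipticCurves.ModularForms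
open Literature.NumberTheory.ComplexMultiplication.EllipticUnits
open Summit.BirchSwinnertonDyer.Rank1Residual

namespace Summit.BirchSwinnertonDyer.Rank1Residual.Additive.GenusSeven

namespace LatticeTypeLaw

/-! ## §8 LEMMA P on the isogeny pair (model-level core) -/

/-- **LEMMA P, model-level core.**  For `𝒞₇`-shaped data — `W/ℚ` globally minimal with `j ∈ {−3375, 255³}`, a globally minimal
partner `W₂` with `j = −3375`, a `ℚ`-isogeny pair `(φ₀, ψ₀)` with `ψ₀ ∘ φ₀ = [e]`, `φ₀ ∘ ψ₀ = [e]`, `e ∈ {1,2}`, the pin's field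
`Kcm ∋ s`, `s² = −7`, `ι₀ : Kcm → ℂ` — the Betti data of the letter EXIST (Néron lattice `L = Ω₂·ι₀(𝓞 Kcm)`, `κ' = s/a₀` where
`Ω(W₂) = Ω₂·ι₀ a₀`, the rational ratio `r`) and `2·v₇(r) + v₇(N κ') ≤ memberType W`: `v₇(r) = 0` (§3); `v₇(N κ') = 1 − v₇(N a₀) ≤ 1`
always; and if `memberType W = 0` then `c₆(W) < 0` (§7), so `c₆(W₂) < 0` (§6), `Ω₂ ∈ iℝ` (F1's sign law), `ι₀ a₀ ∈ iℝ ∩ Λ₋₇`,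
`a₀² = (m²/4)s²`, `κ'² = 4/m²`, `v₇(N κ') = −2v₇(m) ≤ 0`. [cite: Kato2004Asterisque, §15.11 (2) (pp. 261–262) and (15.16.1) (p. 265)]
[cite: CoatesWiles1977, §1 p. 225] [cite: Cox2013, Thm. 10.9] [cite: SilvermanAEC2009, Thm. VI.4.1 (b), Thm. VI.5.1, C.16] -/
theorem latticeTypeLaw_core {W : WeierstrassCurve ℚ} [W.IsElliptic] [W.IsGloballyMinimal]
    (hjW : W.j = -3375 ∨ W.j = 16581375)
    {Kcm : Type} [Field Kcm] [NumberField Kcm] (h2 : Module.finrank ℚ Kcm = 2) (s : 𝓞 Kcm) (hs : (s : Kcm) ^ 2 = -7)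
    (ι₀ : Kcm →+* ℂ) {W₂ : WeierstrassCurve ℚ} [W₂.IsElliptic] [W₂.IsGloballyMinimal] (hj₂ : W₂.j = -3375)
    (φ₀ : Isogeny W W₂) (ψ₀ : Isogeny W₂ W) {e : ℤ} (he : e = 1 ∨ e = 2)
    (hψφ : ∀ P, ψ₀ (φ₀ P) = e • P) (hφψ : ∀ Q, φ₀ (ψ₀ Q) = e • Q) :
    ∃ (L : PeriodPair) (_ : IsNeronLatticeOf (W₂.baseChange ℂ) L) (lam0 : ℂ)
      (_ : ∀ z : ℂ, z ∈ L.lattice ↔ ∃ a : 𝓞 Kcm, z = lam0 * ι₀ (a : Kcm)) (κ' : Kcm)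
      (_ : ι₀ κ' * ((W₂.realPeriodRat : ℝ) : ℂ) = ι₀ (s : Kcm) * lam0) (r : ℚ)
      (_ : (r : ℝ) * W.realPeriodRat = W₂.realPeriodRat),
      2 * padicValRat 7 r + padicValRat 7 (Algebra.norm ℚ κ') ≤ ((memberType W : ℕ) : ℤ) := by
  classical
  haveI : Fact (Nat.Prime 7) := ⟨by norm_num⟩
  haveI : (W₂.baseChange ℂ).IsElliptic := by rw [WeierstrassCurve.baseChange]; infer_instance
  obtain ⟨L₂, hL₂⟩ := exists_isNeronLatticeOf_holds (W₂.baseChange ℂ)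
  obtain ⟨Ω₂, hΩ₂, t₂, hlat₂, ht₂, hsq₂, hiff₂⟩ := exists_cm_generator_of_j_eq_neg_3375 hL₂ hj₂
  have hmem : ∀ z : ℂ, z ∈ L₂.lattice ↔ ∃ a : 𝓞 Kcm, z = Ω₂ * ι₀ (a : Kcm) :=
    mem_lattice_iff_of_eq_mulLeft h2 s hs ι₀ hlat₂
  -- the real period of `W₂` lies in `Λ₂`
  have hR₂ : L₂.IsReal := isReal_neron hL₂
  have hΩW₂ : W₂.realPeriodRat = (W₂.baseChange ℝ).numRealComponents * L₂.minRealPeriod := realPeriodRat_eq hL₂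
  have hΩpos : 0 < W₂.realPeriodRat := W₂.realPeriodRat_pos_holds
  have hΩmem : ((W₂.realPeriodRat : ℝ) : ℂ) ∈ L₂.lattice := by
    rw [hΩW₂]
    push_cast
    rw [← nsmul_eq_mul]
    exact nsmul_mem hR₂.minRealPeriod_mem_lattice _
  obtain ⟨a₀, ha₀⟩ := (hmem _).mp hΩmem
  have hΩC0 : ((W₂.realPeriodRat : ℝ) : ℂ) ≠ 0 := Complex.ofReal_ne_zero.mpr hΩpos.ne'
  have hιa₀ : ι₀ (a₀ : Kcm) ≠ 0 := by
    intro h0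
    rw [h0, mul_zero] at ha₀
    exact hΩC0 ha₀
  have ha₀0 : (a₀ : Kcm) ≠ 0 := fun h ↦ hιa₀ (by rw [h, map_zero])
  have hs0 : (s : Kcm) ≠ 0 := by
    intro h
    rw [h] at hs
    norm_num at hs
  -- `κ' := s / a₀` satisfies the letter's identity on the nose
  have hκ' : ι₀ ((s : Kcm) / (a₀ : Kcm)) * ((W₂.realPeriodRat : ℝ) : ℂ) = ι₀ (s : Kcm) * Ω₂ := by
    rw [ha₀, map_div₀, show ι₀ (s : Kcm) / ι₀ (a₀ : Kcm) * (Ω₂ * ι₀ (a₀ : Kcm)) =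
      ι₀ (s : Kcm) * Ω₂ * (ι₀ (a₀ : Kcm) / ι₀ (a₀ : Kcm)) by ring, div_self hιa₀, mul_one]
  -- the ratio `r`
  obtain ⟨r, hr, hvr⟩ := exists_realPeriodRat_ratio φ₀ ψ₀ he hψφ hφψ
  -- the norm of `κ'`: `v₇(N κ') = 1 − v₇(N a₀) ≤ 1`
  have hNs0 : Algebra.norm ℚ (s : Kcm) ≠ 0 := Algebra.norm_ne_zero_iff.mpr hs0
  have hNa0 : Algebra.norm ℚ (a₀ : Kcm) ≠ 0 := Algebra.norm_ne_zero_iff.mpr ha₀0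
  have hNκ : Algebra.norm ℚ ((s : Kcm) / (a₀ : Kcm)) = Algebra.norm ℚ (s : Kcm) / Algebra.norm ℚ (a₀ : Kcm) := by
    rw [eq_div_iff hNa0, ← map_mul, div_mul_cancel₀ _ ha₀0]
  have hle1 : padicValRat 7 (Algebra.norm ℚ ((s : Kcm) / (a₀ : Kcm))) ≤ 1 := by
    rw [hNκ, padicValRat.div hNs0 hNa0, padicValRat_norm_sqrt h2 s hs]
    linarith [padicValRat_norm_integer_nonneg (Kcm := Kcm) a₀]
  -- imaginary type: `v₇(N κ') ≤ 0`
  have hle0 : t₂ < 0 → padicValRat 7 (Algebra.norm ℚ ((s : Kcm) / (a₀ : Kcm))) ≤ 0 := by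
    intro ht
    -- `Ω₂² = t₂ < 0` ⇒ `Ω₂ ∈ iℝ`
    have hΩ₂re : Ω₂.re = 0 := by
      have hre : (Ω₂ ^ 2).re = t₂ := by rw [hsq₂, Complex.ofReal_re]
      have him : (Ω₂ ^ 2).im = 0 := by rw [hsq₂, Complex.ofReal_im]
      rw [sq, Complex.mul_re] at hre
      rw [sq, Complex.mul_im] at him
      rcases mul_eq_zero.mp (show Ω₂.re * Ω₂.im = 0 by linarith) with h | h
      · exact h
      · exfalso
        rw [h, mul_zero, sub_zero] at hre
        nlinarith [mul_self_nonneg Ω₂.re]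
    -- `ι₀ a₀ = Ω₂⁻¹ Ω(W₂)` is purely imaginary and lies in `Λ₋₇`
    have hιre : (ι₀ (a₀ : Kcm)).re = 0 := by
      have h1 : ι₀ (a₀ : Kcm) = Ω₂⁻¹ * ((W₂.realPeriodRat : ℝ) : ℂ) := by
        rw [ha₀, ← mul_assoc, inv_mul_cancel₀ hΩ₂, one_mul]
      rw [h1, Complex.mul_re, Complex.inv_re, Complex.inv_im, hΩ₂re, Complex.ofReal_re, Complex.ofReal_im]
      ring
    have hιmem : ι₀ (a₀ : Kcm) ∈ (cmPeriodPair (-7)).lattice := by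
      have h1 : Ω₂ * ι₀ (a₀ : Kcm) ∈ L₂.lattice := (hmem _).mpr ⟨a₀, rfl⟩
      rw [hlat₂] at h1
      exact PeriodPair.mul_mem_mulLeft_lattice.mp h1
    obtain ⟨m, n, hmn⟩ := mem_cmPeriodPair_neg_seven hιmem
    obtain ⟨-, him⟩ := re_im_of_eq_cmGen hmn
    have hz : ι₀ (a₀ : Kcm) = ((m * Real.sqrt 7 / 2 : ℝ) : ℂ) * Complex.I :=
      Complex.ext (by simp [hιre]) (by simp [him])
    have h7C : ((Real.sqrt 7 : ℝ) : ℂ) ^ 2 = 7 := by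
      rw [← Complex.ofReal_pow, Real.sq_sqrt (by norm_num : (0 : ℝ) ≤ 7)]
      push_cast
      rfl
    have hz2 : (ι₀ (a₀ : Kcm)) ^ 2 = -(7 * (m : ℂ) ^ 2 / 4) := by
      rw [hz, mul_pow, Complex.I_sq]
      push_cast
      linear_combination (-(m : ℂ) ^ 2 / 4) * h7C
    -- `a₀² = (m²/4)·s²` in `Kcm` (injectivity of `ι₀`)
    have hι7 : ι₀ ((s : Kcm) ^ 2) = -7 := by rw [hs, map_neg, map_ofNat]
    have ha₀sq : (a₀ : Kcm) ^ 2 = algebraMap ℚ Kcm ((m : ℚ) ^ 2 / 4) * (s : Kcm) ^ 2 := by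
      apply ι₀.injective
      rw [map_pow, hz2, map_mul, hι7, eq_ratCast, map_ratCast]
      push_cast
      ring
    have hm0 : (m : ℚ) ≠ 0 := by
      intro hm
      apply hιa₀
      rw [hz, show (m : ℝ) = 0 by exact_mod_cast hm]
      simp
    -- `κ'² = 4/m²`
    have hκ'sq : ((s : Kcm) / (a₀ : Kcm)) ^ 2 = algebraMap ℚ Kcm (4 / (m : ℚ) ^ 2) := by
      have hs2 : (s : Kcm) ^ 2 ≠ 0 := pow_ne_zero 2 hs0
      rw [div_pow, ha₀sq, div_mul_eq_div_div_swap, div_self hs2, one_div, ← map_inv₀, inv_div]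
    have hv := congrArg (fun x : Kcm ↦ padicValRat 7 (Algebra.norm ℚ x)) hκ'sq
    simp only [map_pow, Algebra.norm_algebraMap, h2] at hv
    have h4 : padicValRat 7 (4 : ℚ) = 0 := by
      rw [show (4 : ℚ) = ((4 : ℕ) : ℚ) by norm_num, padicValRat.of_nat, padicValNat.eq_zero_of_not_dvd (by norm_num),
        Nat.cast_zero]
    rw [padicValRat.pow, padicValRat.pow, padicValRat.div (by norm_num) (pow_ne_zero 2 hm0), h4, padicValRat.pow] at hv
    have hvm : 0 ≤ padicValRat 7 (m : ℚ) := by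
      rw [padicValRat.of_int]
      positivity
    push_cast at hv
    linarith
  -- assembly
  refine ⟨L₂, hL₂, Ω₂, hmem, (s : Kcm) / (a₀ : Kcm), hκ', r, hr, ?_⟩
  rw [hvr, mul_zero, zero_add]
  rcases Nat.le_one_iff_eq_zero_or_eq_one.mp (memberType_le_one W) with h0 | h1
  · -- `a = 0`: member law ⇒ `c₆(W) < 0` ⇒ `c₆(W₂) < 0` ⇒ imaginary type
    rw [h0]
    have hW : W.c₆ < 0 := c₆_neg_of_memberType_eq_zero h0
    have ht : t₂ < 0 := by
      rcases lt_or_gt_of_ne ht₂ with h | h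
      · exact h
      · exfalso
        have hpos : 0 < W.c₆ := (c₆_pos_iff_of_isogenyPair hjW hj₂ φ₀ ψ₀ he hψφ hφψ).mpr (hiff₂.mp h)
        linarith
    push_cast
    exact hle0 ht
  · rw [h1]
    push_cast
    exact hle1

end LatticeTypeLaw

/-! ## §9 ★★★ THE LETTER: `stub_latticeTypeLawSeven` (zp v24 l.544–578) VERBATIM -/

open GenusSeven.ArithmeticInputs in
/-- ★★★ **(S-P) = LEMMA P — THE LATTICE-TYPE / PERIOD-POSITION LAW AT 7 ON THE RECORD-FED FRAME**, the TYPE of the registered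
research stub `stub_latticeTypeLawSeven` of zp v24 VERBATIM: at the frame of record the maximal-order partner `D₃.W₂` HAS Betti data
in F-P1-EXACT′'s shape — a Néron lattice `L`, an `𝓞_K`-generator `lam0` of it, `κ′ ∈ Kcm` with `ι₀ κ′·Ω_{W₂} = ι₀(√−7)·lam0`, the
rational real-period ratio `r` — AND `2·v₇(r) + v₇(Nm κ′) ≤ Φ.a` (`Φ.a = memberType W` by `rfl`).  PROOF =
`LatticeTypeLaw.latticeTypeLaw_core` at `W₂ := D₃.W₂` with the record's `ℚ`-isogeny pair `(D₃.φ₀, D₃.ψ₀, D₃.e)` and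
`j(W) ∈ {−3375, 255³}` from `hC : X12.ClassCSeven W`.  No named-fact hypothesis is consumed; of the stub's binders only
`hC, h2, s, hs, ι₀, D₃` and the pin are used. [cite: Kato2004Asterisque, §15.11 (2) (pp. 261–262), (15.16.1) (p. 265), Thm. 12.5 (1) (p. 221)]
[cite: CoatesWiles1977, §1 p. 225] [cite: Cox2013, Thm. 10.9 and §12.C table (12.20)] [cite: SilvermanAEC2009, Thm. VI.4.1 (b), Thm. VI.5.1, C.16]
[cite: Serre1973, VII §4.2] -/
theorem latticeTypeLawSeven :
    ∀ (hstar : Kato2004.exists_zetaClassPosition_of_rank_le_one) (hGZK : rank_eq_analyticRank_of_analyticRank_le_one)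
      (h25 : DeShalit1987.prop25_i_normRelation)
      (hM1 : CM.rayClassField_le_torsionField) (hM1' : CM.torsionField_le_rayClassField_of_conductor)
      (h155u : Kato2004.kato155_isUnit_of_two_le_primeDivisors)
      {W : WeierstrassCurve ℚ} [W.IsElliptic] [W.IsGloballyMinimal] [Fact (Nat.Prime 7)] (hC : X12.ClassCSeven W)
      [ContinuousSMul ℤ_[7] (W.tateModule 7)] (K : ZpExtension ℚ 7) (hK : K.IsCyclotomic)
      {γ : Field.absoluteGaloisGroup ℚ} (hγ : K.IsTopGenerator γ) (I : IwasawaH1Data W 7 K γ)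
      (hR : ∃ z₀ : I.H, Kato2004.IsAdmissibleZetaClass W 7 K hK I z₀)
      (F : GenusFrame) (hbad : ∀ (q : ℕ) [Fact q.Prime], q ≠ 7 → (¬ Good W q ↔ q ∣ F.d))
      (Kcm : Type) [Field Kcm] [NumberField Kcm] (h2 : Module.finrank ℚ Kcm = 2) (s : 𝓞 Kcm) (hs : (s : Kcm) ^ 2 = -7)
      (ι₀ : Kcm →+* ℂ) (hι₀ : ∀ (w : InfinitePlace Kcm) (x : Kcm), ι₀ x = w.embedding x)
      (e : AlgebraicClosure Kcm →+* AlgebraicClosure ℚ)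
      [ContinuousSMul ℤ_[7] ((W.baseChange Kcm).tateModule 7)]
      (γK : Field.absoluteGaloisGroup Kcm) (hγK : (K.restrictOfFinrankEqTwo (by decide) Kcm h2).IsTopGenerator γK)
      (IK : IwasawaH1DataOver (W.baseChange Kcm) 7 (K.restrictOfFinrankEqTwo (by decide) Kcm h2) γK)
      (φ : Isogeny (W.baseChange Kcm) (W.baseChange Kcm)) (hφ : ∀ P, φ (φ P) = (-7 : ℤ) • P)
      (𝔞 : Ideal (𝓞 Kcm)) (h𝔞 : IsTwist 7 (Ideal.span {s} * Ideal.span {((F.d : ℕ) : 𝓞 Kcm)}) 𝔞)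
      (hN𝔞 : Ideal.absNorm 𝔞 = F.normA) (z : ℕ → (AlgebraicClosure Kcm)ˣ)
      (hz : ∀ n : ℕ, IsKatoUnitRep 7 ι₀ (Ideal.span {s} * Ideal.span {((F.d : ℕ) : 𝓞 Kcm)}) (n + 1) 𝔞 (z n))
      (hη : ∀ (g₁ : geomTorsion (W.baseChange Kcm) ((7 : ℤ) ^ 1) →+ geomTorsion (W.baseChange Kcm) ((7 : ℤ) ^ 1)),
        (∀ P, ((g₁ P : geomTorsion (W.baseChange Kcm) ((7 : ℤ) ^ 1)) : geomPoints (W.baseChange Kcm)) =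
          φ (P : geomPoints (W.baseChange Kcm))) →
        ∀ (σ : Field.absoluteGaloisGroup Kcm) (a : ℕ) (ζ' : AlgebraicClosure Kcm), e ζ' = F.ζsys 0 → σ • ζ' = ζ' ^ a →
          ∀ P : geomTorsion (W.baseChange Kcm) ((7 : ℤ) ^ 1), g₁ P = 0 →
            σ • (P : geomPoints (W.baseChange Kcm)) =
              ((PadicInt.toZMod ((F.χD (a : ZMod F.d)) * (F.ω (a : ZMod 7)) ^ 5)).val : ℤ) • (P : geomPoints (W.baseChange Kcm)))
      (D₃ : KummerColumnDataRat W Kcm h2 K IK ι₀ (Ideal.span {s} * Ideal.span {((F.d : ℕ) : 𝓞 Kcm)}) F.d φ)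
      (d : GenusDatum F (normedFamilyOf F Kcm h2 s hs ι₀ e 𝔞 h𝔞 hN𝔞 z hz h155u))
      (ι₇ : ℚ_[7] →+* ℂ)
      (Φ : PinnedKatoGenusFrame W K hK I d),
      Φ = katoGenusFrameOfRecord hstar hGZK h25 hM1 hM1' h155u hC K hK hγ I F hbad Kcm h2 s hs ι₀ hι₀ e γK hγK IK φ hφ 𝔞 h𝔞 hN𝔞 z hz hη
            D₃.toKummerColumnData d →
      ∃ (L : PeriodPair) (_ : IsNeronLatticeOf (D₃.W₂.baseChange ℂ) L) (lam0 : ℂ) (_ : ∀ z : ℂ, z ∈ L.lattice ↔ ∃ a : 𝓞 Kcm, z = lam0 * ι₀ (a : Kcm)) (κ' : Kcm) (_ : ι₀ κ' * ((D₃.W₂.realPeriodRat : ℝ) : ℂ) = ι₀ (s : Kcm) * lam0) (r : ℚ) (_ : (r : ℝ) * W.realPeriodRat = D₃.W₂.realPeriodRat),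
        2 * padicValRat 7 r + padicValRat 7 (Algebra.norm ℚ κ') ≤ (Φ.a : ℤ) := by
  intro hstar hGZK h25 hM1 hM1' h155u W _ _ _ hC _ K hK γ hγ I hR F hbad Kcm _ _ h2 s hs ι₀ hι₀ e _ γK hγK IK φ hφ 𝔞 h𝔞 hN𝔞 z
    hz hη D₃ d ι₇ Φ hΦ
  have hΦa : Φ.a = memberType W := by subst hΦ; rfl
  rw [hΦa]
  haveI := D₃.isElliptic_W₂
  haveI := D₃.isGloballyMinimal_W₂
  exact LatticeTypeLaw.latticeTypeLaw_core (X12.j_eq_of_cmFieldDiscrOfJ_eq_neg_seven hC.2.1) h2 s hs ι₀ D₃.j_W₂ D₃.φ₀ D₃.ψ₀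
    D₃.e_eq D₃.ψφ D₃.φψ

end Summit.BirchSwinnertonDyer.Rank1Residual.Additive.GenusSeven

end
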